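import Summits.HodgeConjecture.HodgeConjecture.Theorems.F0P3SpectralPacketG         -- ★ (N) FILE 3a p841253 (F0P3a-p01 (g11)): `SpectralPacketG`; FILE 2 `GlobalPacket(H)`; FILE 1b `ArchPacketKit`
import Summits.HodgeConjecture.HodgeConjecture.Theorems.F0P3LocalPacketKitOneDim    -- ★ (N) FILE 1c p841729 (F0P2-p01 (g9)): (ℓ8) `OneDimHLaw`, `packetHOfChar`
import Summits.HodgeConjecture.HodgeConjecture.Theorems.F0P3GlobalPacketOfAPackets   -- ★ (N) FILE 3b p841519 (F0P3a-p01 (g11)): `ofAPackets`, `chosenPkt_unique` (the DATA form of §1's pin)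
import HarnessLib

/-!
# (N) DEFS, FILE 3c — «`Q` IS THE PACKET OF GIVEN A-PACKET DATA» and «`ρ` IS THE SINGLETON PACKET OF A CHARACTER FAMILY»: the relational pins of the tuple's
# `PiXi` ∕ `ρXi` slots (Rogawski §13.1 Prop. 13.1.3 (d), p. 199; §12.3 Prop. 12.3.3; §13.3 p. 201; §12.1 type (3))

Cell `hodgecm-mathlib` (D-0151), F0∕P3 «U3-mult», crux H413 (`stmt-HodgeConjecture-24833`), route of record `HCCMUnconditional`.  LEAD F0P3a-plan (g9) «=» on
F0P2-p01 (g9)'s offer (b) (06:57Z: census-first → DEFS box → file; p01 (g11) «=∕≠» as FILE 3 consumer); census = bus line 07:06Z.  New module over ★ FILE 3a + ★ FILE 1c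
(namespaces `…F0P3SpectralPacket.SpectralPacketG` and `…F0P3GlobalPacket.GlobalPacketH`); definition lane (three `def`s: two `Prop`-predicates + one packet constructor),
box-before-file (B-typ03); `--supports stmt-HodgeConjecture-24833 --as helper`.  No instance, no notation, no named fact, no `sorry`; generic in `H′`; the A-packet data are
PARAMETERS (`Pk : ∀ v, CMLocalAPacket L H′ v`, `PkInf`), so consumers plug ★ `xiPacketFamilyOfRecordSCD … ξ` ∕ ★ `archPacketOfRecord … ξ` at their currency.
HONEST LABEL: HC_CM is proved only modulo the printed citations until rung 0 closes; this file proves no printed statement — it NAMES two relations and reads back their pins.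

PRINT.  [§13.1 p. 199] «If `ξ ∈ Π(H)` is one-dimensional, define `Π(ξ) = {πⁿ(ξ), πˢ(ξ)}` … an A-packet … `⟨ξ, ·⟩` ≡ 1 on `Π(ξ)`»; [Prop. 13.1.3 (d)]; [§12.3 Prop. 12.3.3] the
archimedean `Π(ξ_∞) = {J^±_φ, D_φ}`; [§13.3 p. 201] global packets `Π = ⊗ Π_v`; [§12.1 type (3)] one-dimensional representations of `H_v` are packets of cardinality one.
So «`Π(ξ)`» as an element of the tuple's `PG` is THE `Q` whose local packets are the packets CONTAINING `{πⁿ(ξ_v), πˢ(ξ_v)}` with `⟨1, πⁿ⟩ = 1` (★ `ContainsAPacket`, pinned to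
`Q.fin.loc v`; unique by (ℓ7) ★ `UniqLaw` since `πⁿ` is a principal-series constituent) and whose `Π_∞` contains `Π(ξ_∞)` (★ `ContainsAPacketInf`, pinned to `Q.inf`); and
«`ξ` as an element of `PH`» is THE `ρ` with `memH (ρ_v) = {⟦ξ_v⟧}` at every `v` (★ FILE 1c `packetHOfChar`, unique by (ℓ8)).

CONTENTS.
* §1 `SpectralPacketG.IsPacketOf Q Pk PkInf` + read-backs `.containsAPacket`, `.containsAPacketInf`, `.mem_fin_iff`, `.one_fin_πn`, `.mem_inf_iff`; `GlobalPacket.ext_loc`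
  (two finite-place packets with the same `loc` are equal); **`IsPacketOf.fin_eq`** — UNIQUENESS of the finite part under `∀ v, (𝔩 v).UniqLaw` and `∀ v, ¬ (Pk v).πn.IsSupercuspidal`;
  **BRIDGE to ★ FILE 3b** (F0P3a-p01 (g11), the DATA form): `IsPacketOf.fin_eq_ofAPackets : Q.fin = ofAPackets Pk hc hunr` and the converse
  `isPacketOf_of_fin_eq_ofAPackets` — the relational pin and p01's chosen packet `ofAPackets` are the SAME object.
* §2 `GlobalPacketH.IsCharPacket ρ χ hχ`; under (ℓ8) `h8 : ∀ v, (𝔩 v).OneDimHLaw`: `GlobalPacketH.charPacket h8 χ hχ` (THE packet family `{⟦χ_v⟧}_v`),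
  `isCharPacket_charPacket` (existence), **`IsCharPacket.eq_charPacket`** (uniqueness).
* The letter shape FILE 3 will state (not here): «`Π(ξ)` is a discrete packet» = `∀ ξ, ∃ Q : SpectralPacketG 𝔩 𝔞 μG, Q.IsPacketOf (rec ξ) (archRec ξ)` [Thm 13.3.6 (b)];
  `PiXi ξ :=` its witness (pinned up to `fin` by `fin_eq`; the archimedean analogue of (ℓ7) is not a ★ kit law yet), `ρXi ξ := charPacket h8 (fun v => ξ.xiLocalChar v) hχ`.

References: [Rogawski1990] §13.1 Prop. 13.1.3 (d), p. 199; §12.3 Prop. 12.3.3 p. 178; §13.3 p. 201, Thm. 13.3.6 (b); §12.1 (L-packets on `H`, type (3)).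
-/

set_option autoImplicit false
-- the mandated namespace repeats `HodgeConjecture.HodgeConjecture`, as in every `Theorems/*.lean` of this sub-problem
set_option linter.dupNamespace false

noncomputable section

open NumberField IsDedekindDomain MeasureTheory
open scoped Matrix MatrixGroups

open Literature.NumberTheory Literature.NumberTheory.Automorphic Literature.NumberTheory.Automorphic.UnitaryGroup
open Literature.NumberTheory.Rogawski1990 Literature.NumberTheory.GaloisRepresentations
open Literature.RepresentationTheory.BorelWallach2000 Literature.RepresentationTheory.KonnoKonno2007
open Summit.HodgeConjecture.HodgeConjecture.Cruxes.H413.F0P3LocalPacketKit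
open Summit.HodgeConjecture.HodgeConjecture.Cruxes.H413.F0P3ArchPacketKit

/-! ## §0 A `GlobalPacket` is determined by its local packets -/

namespace Summit.HodgeConjecture.HodgeConjecture.Cruxes.H413.F0P3GlobalPacket

variable {L : Type} [Field L] [NumberField L] [IsCMField L] {H' : Matrix (Fin 3) (Fin 3) L}
  {𝔩 : ∀ v : HeightOneSpectrum (𝓞 ↥(maximalRealSubfield L)), LocalPacketKit L H' v}

/-- Two finite-place global packets with the same local packets are equal (`cofinite_unr` is a proof). [cite: Rogawski1990, §13.3 p. 201 ¶2] -/
theorem GlobalPacket.ext_loc {Pg Pg' : GlobalPacket 𝔩} (h : Pg.loc = Pg'.loc) : Pg = Pg' := by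
  cases Pg; cases Pg'
  cases h
  rfl

/-! ## §2 «`ρ` IS THE SINGLETON PACKET FAMILY OF A CHARACTER FAMILY» [§12.1 type (3); §13.1 p. 199] -/

namespace GlobalPacketH

/-- **`ρ.IsCharPacket χ hχ`** — at every finite place the `H`-packet `ρ_v` has member set `{⟦χ_v⟧}` (the one-dimensional smooth irrep ★ `SmoothIrrep.ofChar (χ v) (hχ v)`):
print's «`ξ ∈ Π(H)` one-dimensional» placewise. [cite: Rogawski1990, §13.1 p. 199; §12.1] -/
def IsCharPacket (ρ : GlobalPacketH 𝔩)
    (χ : ∀ v : HeightOneSpectrum (𝓞 ↥(maximalRealSubfield L)),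
      (UnitaryGroup.cmDatum L 2 (Matrix.of fun i j : Fin 2 => if i.val + j.val + 1 = 2 then (1 : L) else 0)).Local v ×
        (UnitaryGroup.cmDatum L 1 (Matrix.of fun i j : Fin 1 => if i.val + j.val + 1 = 1 then (1 : L) else 0)).Local v →* ℂˣ)
    (hχ : ∀ v : HeightOneSpectrum (𝓞 ↥(maximalRealSubfield L)),
      IsOpen (((χ v).ker : Subgroup ((UnitaryGroup.cmDatum L 2 (Matrix.of fun i j : Fin 2 => if i.val + j.val + 1 = 2 then (1 : L) else 0)).Local v ×
        (UnitaryGroup.cmDatum L 1 (Matrix.of fun i j : Fin 1 => if i.val + j.val + 1 = 1 then (1 : L) else 0)).Local v)) :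
        Set ((UnitaryGroup.cmDatum L 2 (Matrix.of fun i j : Fin 2 => if i.val + j.val + 1 = 2 then (1 : L) else 0)).Local v ×
          (UnitaryGroup.cmDatum L 1 (Matrix.of fun i j : Fin 1 => if i.val + j.val + 1 = 1 then (1 : L) else 0)).Local v))) : Prop :=
  ∀ v : HeightOneSpectrum (𝓞 ↥(maximalRealSubfield L)), (𝔩 v).memH (ρ.loc v) = {IrrClass.mk (SmoothIrrep.ofChar (χ v) (hχ v))}

variable
  (h8 : ∀ v : HeightOneSpectrum (𝓞 ↥(maximalRealSubfield L)), (𝔩 v).OneDimHLaw)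
  (χ : ∀ v : HeightOneSpectrum (𝓞 ↥(maximalRealSubfield L)),
    (UnitaryGroup.cmDatum L 2 (Matrix.of fun i j : Fin 2 => if i.val + j.val + 1 = 2 then (1 : L) else 0)).Local v ×
      (UnitaryGroup.cmDatum L 1 (Matrix.of fun i j : Fin 1 => if i.val + j.val + 1 = 1 then (1 : L) else 0)).Local v →* ℂˣ)
  (hχ : ∀ v : HeightOneSpectrum (𝓞 ↥(maximalRealSubfield L)),
    IsOpen (((χ v).ker : Subgroup ((UnitaryGroup.cmDatum L 2 (Matrix.of fun i j : Fin 2 => if i.val + j.val + 1 = 2 then (1 : L) else 0)).Local v ×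
      (UnitaryGroup.cmDatum L 1 (Matrix.of fun i j : Fin 1 => if i.val + j.val + 1 = 1 then (1 : L) else 0)).Local v)) :
      Set ((UnitaryGroup.cmDatum L 2 (Matrix.of fun i j : Fin 2 => if i.val + j.val + 1 = 2 then (1 : L) else 0)).Local v ×
        (UnitaryGroup.cmDatum L 1 (Matrix.of fun i j : Fin 1 => if i.val + j.val + 1 = 1 then (1 : L) else 0)).Local v)))

/-- **THE singleton packet family `{⟦χ_v⟧}_v` of a character family** under (ℓ8) at every place (★ FILE 1c `packetHOfChar`) — FILE 3's `ρXi ξ` at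
`χ v := ξ.xiLocalChar v`. [cite: Rogawski1990, §13.1 p. 199; §12.1] -/
def charPacket : GlobalPacketH 𝔩 :=
  ⟨fun v => (𝔩 v).packetHOfChar (h8 v) (χ v) (hχ v)⟩

/-- `charPacket` IS the character's packet family (existence of the pin). [cite: Rogawski1990, §12.1] -/
theorem isCharPacket_charPacket : (charPacket h8 χ hχ).IsCharPacket χ hχ :=
  fun v => (𝔩 v).memH_packetHOfChar (h8 v) (χ v) (hχ v)

/-- **UNIQUENESS**: any packet family with member sets `{⟦χ_v⟧}` is `charPacket` (ℓ8). [cite: Rogawski1990, §12.1] -/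
theorem IsCharPacket.eq_charPacket {ρ : GlobalPacketH 𝔩} (hρ : ρ.IsCharPacket χ hχ) : ρ = charPacket h8 χ hχ := by
  cases ρ with
  | mk loc =>
    simp only [charPacket, GlobalPacketH.mk.injEq]
    funext v
    exact (𝔩 v).eq_packetHOfChar_of_mem (h8 v) (χ v) (hχ v) (loc v) (by rw [hρ v]; exact Finset.mem_singleton_self _)

end GlobalPacketH

end Summit.HodgeConjecture.HodgeConjecture.Cruxes.H413.F0P3GlobalPacket

/-! ## §1 «`Q` IS THE PACKET OF THE A-PACKET DATA `(Pk, PkInf)`» [Prop. 13.1.3 (d); p. 199; Prop. 12.3.3; p. 201] -/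

namespace Summit.HodgeConjecture.HodgeConjecture.Cruxes.H413.F0P3SpectralPacket.SpectralPacketG

open Summit.HodgeConjecture.HodgeConjecture.Cruxes.H413.F0P3GlobalPacket

variable {L : Type} [Field L] [NumberField L] [IsCMField L] {H' : Matrix (Fin 3) (Fin 3) L}
  {𝔩 : ∀ v : HeightOneSpectrum (𝓞 ↥(maximalRealSubfield L)), LocalPacketKit L H' v} {𝔞 : ArchPacketKit}
  {μ : Measure (adelicGroupData (↥(maximalRealSubfield L)) L (IsCMField.complexConj L) 3 H').automorphicQuotient}
  [SMulInvariantMeasure (adelicGroupData (↥(maximalRealSubfield L)) L (IsCMField.complexConj L) 3 H').Adelic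
    (adelicGroupData (↥(maximalRealSubfield L)) L (IsCMField.complexConj L) 3 H').automorphicQuotient μ]

/-- **`Q.IsPacketOf Pk PkInf`** — the discrete packet `Q` has, at every finite place, THE local packet containing the A-packet `Pk v = ⟨πⁿ, πˢ⟩` with `⟨1, πⁿ⟩ = 1`
(★ `ContainsAPacket` with the witness pinned to `Q.fin.loc v`) and, at infinity, THE packet containing `PkInf` with `⟨1, πⁿ_∞⟩ = 1` (★ `ContainsAPacketInf`, pinned to `Q.inf`).
Consumers: `Pk := xiPacketFamilyOfRecordSCD … ξ`, `PkInf := archPacketOfRecord … ξ` — then `Q` «is `Π(ξ)`». [cite: Rogawski1990, §13.1 Prop. 13.1.3 (d), p. 199; §12.3 Prop. 12.3.3 p. 178; §13.3 p. 201] -/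
def IsPacketOf (Q : SpectralPacketG 𝔩 𝔞 μ) (Pk : ∀ v : HeightOneSpectrum (𝓞 ↥(maximalRealSubfield L)), CMLocalAPacket L H' v)
    (PkInf : LocalAPacket (GKIrrClass (uFormGroup (Fin 2) (Fin 1)))) : Prop :=
  (∀ v : HeightOneSpectrum (𝓞 ↥(maximalRealSubfield L)),
      (∀ c : IrrClass ((UnitaryGroup.cmDatum L 3 H').Local v), c ∈ (𝔩 v).mem (Q.fin.loc v) ↔ (c = (Pk v).πn ∨ (Pk v).πs = some c)) ∧
        (𝔩 v).one (Q.fin.loc v) (Pk v).πn = 1) ∧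
    ((∀ c : GKIrrClass (uFormGroup (Fin 2) (Fin 1)), c ∈ 𝔞.memInf Q.inf ↔ (c = PkInf.πn ∨ PkInf.πs = some c)) ∧ 𝔞.oneInf Q.inf PkInf.πn = 1)

variable {Q Q' : SpectralPacketG 𝔩 𝔞 μ} {Pk : ∀ v : HeightOneSpectrum (𝓞 ↥(maximalRealSubfield L)), CMLocalAPacket L H' v}
  {PkInf : LocalAPacket (GKIrrClass (uFormGroup (Fin 2) (Fin 1)))}

/-- The finite components witness ★ `ContainsAPacket` at every place. [cite: Rogawski1990, §13.1 Prop. 13.1.3 (d), p. 199] -/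
theorem IsPacketOf.containsAPacket (h : Q.IsPacketOf Pk PkInf) (v : HeightOneSpectrum (𝓞 ↥(maximalRealSubfield L))) :
    (𝔩 v).ContainsAPacket (Pk v) :=
  ⟨Q.fin.loc v, h.1 v⟩

/-- The archimedean component witnesses ★ `ContainsAPacketInf`. [cite: Rogawski1990, §12.3 Prop. 12.3.3 p. 178] -/
theorem IsPacketOf.containsAPacketInf (h : Q.IsPacketOf Pk PkInf) : 𝔞.ContainsAPacketInf PkInf :=
  ⟨Q.inf, h.2⟩

/-- Membership in `Q_v` is membership in the A-packet `Pk v`. [cite: Rogawski1990, §13.1 p. 199] -/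
theorem IsPacketOf.mem_fin_iff (h : Q.IsPacketOf Pk PkInf) (v : HeightOneSpectrum (𝓞 ↥(maximalRealSubfield L)))
    (c : IrrClass ((UnitaryGroup.cmDatum L 3 H').Local v)) :
    c ∈ (𝔩 v).mem (Q.fin.loc v) ↔ (c = (Pk v).πn ∨ (Pk v).πs = some c) :=
  (h.1 v).1 c

/-- `⟨1, πⁿ(ξ_v)⟩ = 1` in `Q_v`. [cite: Rogawski1990, §13.1 p. 199] -/
theorem IsPacketOf.one_fin_πn (h : Q.IsPacketOf Pk PkInf) (v : HeightOneSpectrum (𝓞 ↥(maximalRealSubfield L))) :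
    (𝔩 v).one (Q.fin.loc v) (Pk v).πn = 1 :=
  (h.1 v).2

/-- Membership in `Q_∞` is membership in `PkInf`. [cite: Rogawski1990, §12.3 Prop. 12.3.3 p. 178] -/
theorem IsPacketOf.mem_inf_iff (h : Q.IsPacketOf Pk PkInf) (c : GKIrrClass (uFormGroup (Fin 2) (Fin 1))) :
    c ∈ 𝔞.memInf Q.inf ↔ (c = PkInf.πn ∨ PkInf.πs = some c) :=
  h.2.1 c

/-- **UNIQUENESS OF THE FINITE PART** under (ℓ7) at every place, when every `πⁿ_v` is non-supercuspidal (print: `πⁿ(ξ_v)` is a principal-series constituent): two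
discrete packets of the same A-packet data have the same finite-place packet (★ `ContainsAPacket.unique`). [cite: Rogawski1990, §13.1 p. 199; Prop. 13.1.3 (d)] -/
theorem IsPacketOf.fin_eq (h𝔩 : ∀ v : HeightOneSpectrum (𝓞 ↥(maximalRealSubfield L)), (𝔩 v).UniqLaw)
    (hn : ∀ v : HeightOneSpectrum (𝓞 ↥(maximalRealSubfield L)), ¬ (Pk v).πn.IsSupercuspidal)
    (h : Q.IsPacketOf Pk PkInf) (h' : Q'.IsPacketOf Pk PkInf) : Q.fin = Q'.fin :=
  GlobalPacket.ext_loc (funext fun v => LocalPacketKit.ContainsAPacket.unique (𝔩 v) (h𝔩 v) (Pk v) (hn v) _ _ (h.1 v) (h'.1 v))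

/-- And the archimedean member sets agree. [cite: Rogawski1990, §12.3 Prop. 12.3.3 p. 178] -/
theorem IsPacketOf.memInf_eq (h : Q.IsPacketOf Pk PkInf) (h' : Q'.IsPacketOf Pk PkInf) : 𝔞.memInf Q.inf = 𝔞.memInf Q'.inf := by
  ext c
  rw [h.mem_inf_iff, h'.mem_inf_iff]

/-- **BRIDGE TO ★ FILE 3b's DATA FORM**: under (ℓ7) and non-supercuspidal `πⁿ_v`, the finite part of a packet OF the A-packet data IS p01's `ofAPackets`
(the chosen packets), for any admissible `hunr`. [cite: Rogawski1990, §13.3 p. 201 ¶2; §13.1 p. 199] -/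
theorem IsPacketOf.fin_eq_ofAPackets (h𝔩 : ∀ v : HeightOneSpectrum (𝓞 ↥(maximalRealSubfield L)), (𝔩 v).UniqLaw)
    (hn : ∀ v : HeightOneSpectrum (𝓞 ↥(maximalRealSubfield L)), ¬ (Pk v).πn.IsSupercuspidal) (h : Q.IsPacketOf Pk PkInf)
    (hc : ∀ v : HeightOneSpectrum (𝓞 ↥(maximalRealSubfield L)), (𝔩 v).ContainsAPacket (Pk v))
    (hunr : ∀ᶠ v in Filter.cofinite, (𝔩 v).unr (chosenPkt Pk hc v)) :
    Q.fin = ofAPackets Pk hc hunr :=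
  GlobalPacket.ext_loc (funext fun v => chosenPkt_unique Pk hc v (h𝔩 v) (hn v) _ (h.1 v))

/-- **CONVERSELY**: a discrete packet whose finite part IS `ofAPackets Pk …` and whose archimedean packet contains `PkInf` with `⟨1, πⁿ_∞⟩ = 1` is a packet OF the data.
[cite: Rogawski1990, §13.3 p. 201 ¶2; §12.3 Prop. 12.3.3 p. 178] -/
theorem isPacketOf_of_fin_eq_ofAPackets
    (hc : ∀ v : HeightOneSpectrum (𝓞 ↥(maximalRealSubfield L)), (𝔩 v).ContainsAPacket (Pk v))
    (hunr : ∀ᶠ v in Filter.cofinite, (𝔩 v).unr (chosenPkt Pk hc v))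
    (hfin : Q.fin = ofAPackets Pk hc hunr)
    (hinf : (∀ c : GKIrrClass (uFormGroup (Fin 2) (Fin 1)), c ∈ 𝔞.memInf Q.inf ↔ (c = PkInf.πn ∨ PkInf.πs = some c)) ∧ 𝔞.oneInf Q.inf PkInf.πn = 1) :
    Q.IsPacketOf Pk PkInf :=
  ⟨fun v => by rw [hfin]; exact chosenPkt_spec Pk hc v, hinf⟩

end Summit.HodgeConjecture.HodgeConjecture.Cruxes.H413.F0P3SpectralPacket.SpectralPacketG

end
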